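import Summits.BirchSwinnertonDyer.BirchSwinnertonDyer.Theorems.KatoDescentPotSupersingularASideZetaLinePairingForm
import Summits.BirchSwinnertonDyer.BirchSwinnertonDyer.Theorems.KatoDescentPotSupersingularKummerKernelOrthogonal
import Mathlib.NumberTheory.Padics.RingHoms
import HarnessLib

/-!
# Brick (b) of crux M's level-0 ledger against ONE class: the zeta line `ℤ_p y₀` pairs through its generator — `B_k(ℤ_p y₀) = ℤ·f_k(y₀)`,
# `𝓚_k ⊓ {}^⊥B_k(ℤ_p y₀) = {x ∈ 𝓚_k : ⟨x, f_k(y₀)⟩_k = 0}` (`⟨x, f_k(y₀)⟩_k = inv_p(x ∪_desc loc_p ι′_* red_k y₀)`, part 35) — and the level-0 count from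
# «`#{x ∈ 𝓚_k : ⟨x, f_k y₀⟩_k = 0} ∣ #W(ℚ_p)[p^k]·p^e`»
# (route `KatoDescentPotSupersingular` / `…Tame…`, crux M = stmt-BirchSwinnertonDyer-19196; route-free helper)

Seat `bsd-potss-rkm` g20 (prover; cell `bsd-potss`), item stmt-BirchSwinnertonDyer-19196 (`--supports … --as helper`; closes nothing).
HONEST FRAMING: BSD is not proved by any of this; nothing is booked; theorems only (no definition, no named fact).  CONDITIONAL (parts 53–55) on the named
fact `poitouTate_selmerStructure_duality ℚ` and on the displayed brick (b⁗).

## What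

The explicit reciprocity law computes ONE pairing: `⟨δ_k(P), loc_p red_k y₀⟩_k` for `P ∈ W(ℚ_p)`.  This file reduces brick (b‴) of part 55 (a count over
the annihilator of the whole image `B_k(ℤ_p y₀)`) to that single class:

* `map_toAddSubgroup_span_singleton_eq_zmultiples` — for an additive `f : M → G` whose target is killed by `p^r`, `f(ℤ_p y₀) = ℤ·f(y₀)`
  (`ℤ` is dense in `ℤ_p` modulo `p^r`, `PadicInt.appr`);
* `annLeft_zmultiples_eq_ker` — `{}^⊥(ℤ·g) = ker ⟨·, g⟩`;
* `kummer_inf_annLeft_image_eq_inf_ker` — at `v_p`, level `p^k`, PT family at level `p^j p^k`, any additive `f₀ : H¹(ℚ,T_pW) → H¹(ℚ,E[p^k])`: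
  `𝓚_k ⊓ {}^⊥B_k(ℤ_p y₀) = 𝓚_k ⊓ ker ⟨·, f_k(y₀)⟩_k` (`f_k = loc_p ∘ (desc^♭)_* ∘ f₀`, `f₀ = ι′_* ∘ red_{p^k}` in the ledger);
* (no new declaration) `⟨x, f_k(y₀)⟩_k = inv_p(x ∪_desc loc_p(f₀ y₀))`: rewrite `galoisCohomology.localization` with the tree's naturality
  `galoisCohomology.res_map_one` (`res ∘ H¹(desc^♭) = H¹(desc^♭|) ∘ res`) and apply part 35's L1-translation
  `KummerTowerOrthogonal.localTatePairingZMod_map_pairingDualIntertwining` — stated there for a general place; not restated here (the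
  `ℚ_p`-specialised cup-product spelling is left to the consumer);
* **`tamagawa_mul_sha_mul_index_le_ppart_of_zetaClassOrthogonalCount`** — part 55 with (b⁗) «`#(𝓚_k ⊓ ker ⟨·, f_k(y₀)⟩_k) ∣ #W(ℚ_p)[p^k]·p^e` for `k ≫ 0`
  and all auxiliary data»: **`p^{v_p(Tam W)}·#Ш(W)[p^∞]·[A : ℤ_p y₀] ≤ p^{v_p(c_p)}·#Sel_str^{ur}(W[p^∞])·p^e·(p^{v_p #W(ℚ)_tors})²`**.

So the input asked of the explicit-reciprocity side is exactly: for `k ≫ 0`, the number of local Kummer classes `δ_k(P)`, `P ∈ W(ℚ_p)/p^k`, with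
`inv_p(δ_k(P) ∪_desc loc_p red_k y₀) = 0` divides `#W(ℚ_p)[p^k]·p^e` — with Kato's value `e = ord_p(L(W,1)/Ω) + v_p(λ(0)) + t_p − v_p(c_p)`
(Lemma 14.18: `⟨δ_k P, red_k y₀⟩ = p^{-k}·Tr(log_ω(P)·exp*_ω(y₀))`, image of `log_ω` = `p^{t_p−v_p(c_p)}ℤ_p`).

References: K. Kato, Astérisque 295 (2004), Lemma 14.18 (pp. 247–248), Prop. 14.16 (2) (pp. 244–245), Prop. 14.21 / Thm. 16.6 [Kato2004Asterisque];
S. Bloch, K. Kato (1990) Prop. 3.8, Ex. 3.11 [BlochKato1990]; J. S. Milne, *ADT* I Prop. 0.19, §6 proof of Prop. 6.9 [MilneADT2006].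
-/

-- the summit and its single problem are both named `BirchSwinnertonDyer` (registry layout D-0017)
set_option linter.dupNamespace false
set_option autoImplicit false

noncomputable section

open scoped Classical ContRepresentation NumberField AddSubgroup
open CategoryTheory Function Field NumberField IsDedekindDomain WeierstrassCurve
open Literature.NumberTheory.EllipticCurves Literature.NumberTheory.GaloisRepresentations
  Literature.NumberTheory.GaloisRepresentations.DiscreteGaloisModule Literature.NumberTheory.GaloisCohomology
open Literature.NumberTheory.EllipticCurves.Kato2004 Literature.NumberTheory.EllipticCurves.Kato2004.EulerSystemValues
open Summit.BirchSwinnertonDyer.Rank1Residual.X11b.Levels Summit.BirchSwinnertonDyer.Rank1Residual.X11b.LocBridge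
  Summit.BirchSwinnertonDyer.Rank1Residual.X11b.LevelKummer Summit.BirchSwinnertonDyer.Rank1Residual.X11b.FiniteDuality
  Summit.BirchSwinnertonDyer.Rank1Residual.X11b.AcSelmer
open Summit.BirchSwinnertonDyer.Rank1Residual.GaloisImage
open Summit.BirchSwinnertonDyer.BirchSwinnertonDyer.Theorems.KummerTowerOrthogonal
open Summit.BirchSwinnertonDyer.BirchSwinnertonDyer.Theorems.ASideJunction

namespace Summit.BirchSwinnertonDyer.BirchSwinnertonDyer.Theorems.KatoFiniteLevelCount

/-! ## §1 The zeta line pairs through its generator -/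

section Generator

variable {p : ℕ} [hp : Fact p.Prime] {M G : Type*} [AddCommGroup M] [Module ℤ_[p] M] [AddCommGroup G]

/-- **`f(ℤ_p y₀) = ℤ·f(y₀)`** for an additive `f : M → G` whose target is killed by `p^r`: `c = m + p^r w` with `m ∈ ℕ` (`PadicInt.appr`), so
`f(c • y₀) = m • f(y₀)`. [cite: Kato2004Asterisque, proof of Lemma 14.18 (pp. 247–248)] -/
theorem map_toAddSubgroup_span_singleton_eq_zmultiples (f : M →+ G) (r : ℕ) (hG : ∀ g : G, p ^ r • g = 0) (y₀ : M) :
    ((ℤ_[p] ∙ y₀).toAddSubgroup).map f = AddSubgroup.zmultiples (f y₀) := by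
  apply le_antisymm
  · rintro _ ⟨y, hy, rfl⟩
    rw [SetLike.mem_coe, Submodule.mem_toAddSubgroup, Submodule.mem_span_singleton] at hy
    obtain ⟨c, rfl⟩ := hy
    obtain ⟨w, hw⟩ := Ideal.mem_span_singleton.mp (PadicInt.appr_spec r c)
    have hc : c = (PadicInt.appr c r : ℤ_[p]) + (p : ℤ_[p]) ^ r * w := by rw [← hw]; ring
    rw [hc, add_smul, map_add, Nat.cast_smul_eq_nsmul, map_nsmul, mul_smul, ← Nat.cast_pow, Nat.cast_smul_eq_nsmul, map_nsmul,
      hG, add_zero]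
    exact AddSubgroup.nsmul_mem _ (AddSubgroup.mem_zmultiples _) _
  · rw [AddSubgroup.zmultiples_le]
    exact ⟨y₀, Submodule.mem_span_singleton_self y₀, rfl⟩

omit hp [Module ℤ_[p] M] in
/-- **`{}^⊥(ℤ·g) = ker ⟨·, g⟩`**: the left annihilator of the cyclic subgroup generated by `g` is the kernel of pairing with `g`.
[cite: MilneADT2006, Ch. I §0, Prop. 0.19] -/
theorem annLeft_zmultiples_eq_ker {n : ℕ} (b : M →+ G →+ ZMod n) (g : G) : annLeft b (AddSubgroup.zmultiples g) = (b.flip g).ker := by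
  ext x
  rw [mem_annLeft_iff, AddMonoidHom.mem_ker, AddMonoidHom.flip_apply]
  constructor
  · exact fun h => h g (AddSubgroup.mem_zmultiples g)
  · intro h y hy
    obtain ⟨m, rfl⟩ := AddSubgroup.mem_zmultiples_iff.mp hy
    rw [map_zsmul, h, smul_zero]

end Generator

/-! ## §2 At `v_p`, level `p^k`: `𝓚_k ⊓ {}^⊥B_k(ℤ_p y₀) = 𝓚_k ⊓ ker ⟨·, f_k(y₀)⟩` -/

section Local

variable (W : WeierstrassCurve ℚ) [W.IsElliptic] (p k j : ℕ) [Fact p.Prime] [ContinuousSMul ℤ_[p] (W.tateModule p)]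
  (e₀ : geomTorsion W ((p ^ j * p ^ k : ℕ) : ℤ) → geomTorsion W ((p ^ j * p ^ k : ℕ) : ℤ) → AlgebraicClosure ℚ)
  (hμ : ∀ S T, e₀ S T ^ (p ^ j * p ^ k) = 1)
  (hadd₁ : ∀ S₁ S₂ T, e₀ (S₁ + S₂) T = e₀ S₁ T * e₀ S₂ T)
  (hadd₂ : ∀ S T₁ T₂, e₀ S (T₁ + T₂) = e₀ S T₁ * e₀ S T₂)
  (hgal : ∀ (σ : absoluteGaloisGroup ℚ) (S T : geomTorsion W ((p ^ j * p ^ k : ℕ) : ℤ)), σ • e₀ S T = e₀ (σ • S) (σ • T))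
  [Finite (geomTorsion W ((p ^ k : ℕ) : ℤ))]
  (inv : LocalInvariants ℚ (p ^ j * p ^ k)) (f₀ : H1 (tateRep W p) ⊤ →+ galoisCohomology (W.torsionGaloisModule ((p ^ k : ℕ) : ℤ)) 1)
  (y₀ : H1 (tateRep W p) ⊤)

/-- **`𝓚_k ⊓ {}^⊥B_k(ℤ_p y₀) = 𝓚_k ⊓ ker ⟨·, f_k(y₀)⟩_k`** for `B_k(Y) = loc_p ((desc^♭)_* (f₀ Y))` (`f₀` any additive map into `H¹(ℚ, E[p^k])`, in the
ledger `ι′_* ∘ red_{p^k}`): the target `H¹(ℚ_p, E[p^k]^D)` is killed by `p^j p^k`, so `B_k(ℤ_p y₀) = ℤ·f_k(y₀)` (§1).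
[cite: Kato2004Asterisque, proof of Lemma 14.18 (pp. 247–248)] [cite: MilneADT2006, Ch. I §0, Prop. 0.19] -/
theorem kummer_inf_annLeft_image_eq_inf_ker :
    haveI := neZero_pow p j; haveI := neZero_pow p k
    W.kummerSelmerStructure ((p ^ k : ℕ) : ℤ) (Sum.inr (primePlace p)) ⊓
        annLeft (localTatePairingZMod (W.torsionGaloisModule ((p ^ k : ℕ) : ℤ)) (p ^ j * p ^ k)
          (Sum.inr (primePlace p)) (inv (Sum.inr (primePlace p))))
          ((((ℤ_[p] ∙ y₀).toAddSubgroup.map f₀).map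
              (galoisCohomology.map (DiscreteGaloisModule.pairingDualIntertwining
                (ρ₁ := W.torsionGaloisModule ((p ^ k : ℕ) : ℤ)) (ρ₂ := W.torsionGaloisModule ((p ^ k : ℕ) : ℤ))
                (B := descendHom W (p ^ j) (p ^ k) e₀ hμ hadd₁ hadd₂)
                (descendHom_smul W (p ^ j) (p ^ k) e₀ hμ hadd₁ hadd₂ hgal)) 1)).map
            (galoisCohomology.localization ((W.torsionGaloisModule ((p ^ k : ℕ) : ℤ)).tateDual (p ^ j * p ^ k))
              (Sum.inr (primePlace p)) 1)) =
      W.kummerSelmerStructure ((p ^ k : ℕ) : ℤ) (Sum.inr (primePlace p)) ⊓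
        ((localTatePairingZMod (W.torsionGaloisModule ((p ^ k : ℕ) : ℤ)) (p ^ j * p ^ k)
            (Sum.inr (primePlace p)) (inv (Sum.inr (primePlace p)))).flip
          (galoisCohomology.localization ((W.torsionGaloisModule ((p ^ k : ℕ) : ℤ)).tateDual (p ^ j * p ^ k))
              (Sum.inr (primePlace p)) 1
            (galoisCohomology.map (DiscreteGaloisModule.pairingDualIntertwining
                (ρ₁ := W.torsionGaloisModule ((p ^ k : ℕ) : ℤ)) (ρ₂ := W.torsionGaloisModule ((p ^ k : ℕ) : ℤ))
                (B := descendHom W (p ^ j) (p ^ k) e₀ hμ hadd₁ hadd₂)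
                (descendHom_smul W (p ^ j) (p ^ k) e₀ hμ hadd₁ hadd₂ hgal)) 1
              (f₀ y₀)))).ker := by
  haveI := neZero_pow p j; haveI := neZero_pow p k
  have hB : ∀ y : galoisCohomology
      (((W.torsionGaloisModule ((p ^ k : ℕ) : ℤ)).tateDual (p ^ j * p ^ k)).toLocal (Sum.inr (primePlace p))) 1, p ^ (j + k) • y = 0 :=
    fun y => by
      rw [pow_add]
      exact galoisCohomology.nsmul_eq_zero_of_forall _ (fun f => DiscreteGaloisModule.TateDual.nsmul_eq_zero f) y
  simp only [AddSubgroup.map_map]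
  rw [map_toAddSubgroup_span_singleton_eq_zmultiples _ (j + k) hB, annLeft_zmultiples_eq_ker]
  rfl

end Local

/-! ## §3 The count from the single-class form -/

section Count

variable (W : WeierstrassCurve ℚ) [W.IsElliptic] (p : ℕ) [Fact p.Prime] [ContinuousSMul ℤ_[p] (W.tateModule p)]
  (𝓤inf 𝓢inf : SelmerStructure (primaryGaloisModule W p))

/-- **THE LEVEL-0 COUNT OF CRUX M FROM BRICK (b) AGAINST THE ZETA CLASS:
`p^{v_p(Tam W)}·#Ш(W)[p^∞]·[A : ℤ_p y₀] ≤ p^{v_p(c_p)}·#Sel_str^{ur}(W[p^∞])·p^e·(p^{v_p #W(ℚ)_tors})²`** under (b⁗) «for `k ≫ 0` and all auxiliary data,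
`#{x ∈ 𝓚_k : ⟨x, f_k(y₀)⟩_k = 0} ∣ #W(ℚ_p)[p^k]·p^e`» (the local Tate pairing of the Kummer classes of `W(ℚ_p)` with the ONE class
`f_k(y₀) = loc_p (desc^♭)_* ι′_* red_k y₀`, `= inv_p(· ∪_desc loc_p ι′_* red_k y₀)` by part 35's L1-translation; Kato Lemma 14.18 via the
explicit reciprocity law — displayed, NOT proved) and the named fact `poitouTate_selmerStructure_duality ℚ`; other hypotheses as part 54.
[cite: Kato2004Asterisque, Prop. 14.16 and its proof (pp. 244–245), Lemma 14.18 (pp. 247–248)] [cite: MilneADT2006, Ch. I, Prop. 0.19, Thm. 4.10 (b)] -/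
theorem tamagawa_mul_sha_mul_index_le_ppart_of_zetaClassOrthogonalCount (hPT : poitouTate_selmerStructure_duality ℚ) (hodd : p ≠ 2) (T : Finset (HeightOneSpectrum (𝓞 ℚ)))
    (hpT : primePlace p ∈ T) (hT : ∀ v : HeightOneSpectrum (𝓞 ℚ), v ∉ T → W.HasGoodReductionAt v)
    [Finite W.toAffine.Point] [Finite (AddCommGroup.primaryComponent (↥W.sha) p)]
    (hUp : 𝓤inf (Sum.inr (primePlace p)) = ⊤)
    (hUur : ∀ v : HeightOneSpectrum (𝓞 ℚ), v ≠ primePlace p →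
      𝓤inf (Sum.inr v) = unramifiedSubgroup (GaloisRep.toLocal v (primaryGaloisModule W p)) 1)
    (hUinl : ∀ w : InfinitePlace ℚ, 𝓤inf (Sum.inl w) = ⊤)
    (hSp : 𝓢inf (Sum.inr (primePlace p)) = ⊥)
    (hSur : ∀ v : HeightOneSpectrum (𝓞 ℚ), v ≠ primePlace p →
      𝓢inf (Sum.inr v) = unramifiedSubgroup (GaloisRep.toLocal v (primaryGaloisModule W p)) 1)
    (hSinl : ∀ w : InfinitePlace ℚ, 𝓢inf (Sum.inl w) = ⊤)
    (y₀ : H1 (tateRep W p) ⊤) (hy₀ : y₀ ∈ integralH1 (tateRep W p) p ⊤) (N : ℕ)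
    (hN : ∀ a ∈ integralH1 (tateRep W p) p ⊤, ((p ^ N : ℕ) : ℤ) • a ∈ (ℤ_[p] ∙ y₀).toAddSubgroup) (e : ℕ)
    (hb : ∃ k₁ : ℕ, ∀ k : ℕ, k₁ ≤ k → ∀ j : ℕ,
      haveI := neZero_pow p j; haveI := neZero_pow p k
      haveI : Finite (geomTorsion W ((p ^ k : ℕ) : ℤ)) := finite_geomTorsion_pow W p k
      ∀ (inv : LocalInvariants ℚ (p ^ j * p ^ k)), inv.SumLocalTermEqZero → inv.IsPerfect →
      ∀ (ε : geomTorsion W ((p ^ j * p ^ k : ℕ) : ℤ) → geomTorsion W ((p ^ j * p ^ k : ℕ) : ℤ) → AlgebraicClosure ℚ)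
        (hμ : ∀ S T, ε S T ^ (p ^ j * p ^ k) = 1)
        (hadd₁ : ∀ S₁ S₂ T, ε (S₁ + S₂) T = ε S₁ T * ε S₂ T)
        (hadd₂ : ∀ S T₁ T₂, ε S (T₁ + T₂) = ε S T₁ * ε S T₂)
        (hgal : ∀ (σ : absoluteGaloisGroup ℚ) (S T : geomTorsion W ((p ^ j * p ^ k : ℕ) : ℤ)), σ • ε S T = ε (σ • S) (σ • T)),
      Nat.card ↥(W.kummerSelmerStructure ((p ^ k : ℕ) : ℤ) (Sum.inr (primePlace p)) ⊓
          ((localTatePairingZMod (W.torsionGaloisModule ((p ^ k : ℕ) : ℤ)) (p ^ j * p ^ k)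
            (Sum.inr (primePlace p)) (inv (Sum.inr (primePlace p)))).flip
            ((galoisCohomology.localization ((W.torsionGaloisModule ((p ^ k : ℕ) : ℤ)).tateDual (p ^ j * p ^ k))
                  (Sum.inr (primePlace p)) 1)
            ((galoisCohomology.map (DiscreteGaloisModule.pairingDualIntertwining
                    (ρ₁ := W.torsionGaloisModule ((p ^ k : ℕ) : ℤ)) (ρ₂ := W.torsionGaloisModule ((p ^ k : ℕ) : ℤ))
                    (B := descendHom W (p ^ j) (p ^ k) ε hμ hadd₁ hadd₂)
                    (descendHom_smul W (p ^ j) (p ^ k) ε hμ hadd₁ hadd₂ hgal)) 1)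
              ((((galoisCohomology.map (W.torsionInclusion (intPow_dvd_natCast_pow p k)) 1).comp
                      (ofTopSubgroup (W.torsionGaloisModule ((p : ℤ) ^ k)).toTopRep 1).hom.toLinearMap.toAddMonoidHom).comp
                    (reduceH1Pk W p k ⊤)) y₀)))).ker) ∣
        Nat.card (nsmulAddMonoidHom (p ^ k) : (W.baseChange ((primePlace p).adicCompletion ℚ)).toAffine.Point →+ _).ker * p ^ e) :
    p ^ padicValNat p W.tamagawaProduct * Nat.card (AddCommGroup.primaryComponent (↥W.sha) p) *
        (ℤ_[p] ∙ y₀).toAddSubgroup.relIndex (integralH1 (tateRep W p) p ⊤).toAddSubgroup ≤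
      p ^ padicValNat p ((W.baseChange ((primePlace p).adicCompletion ℚ)).localTamagawaNumber
          ((primePlace p).adicCompletionIntegers ℚ)) * Nat.card 𝓢inf.selmerGroup * p ^ e * (p ^ padicValNat p W.torsionOrder) ^ 2   := by
  obtain ⟨k₁, hb⟩ := hb
  refine tamagawa_mul_sha_mul_index_le_ppart_of_kummerOrthogonalCount W p 𝓤inf 𝓢inf hPT hodd T hpT hT hUp hUur hUinl hSp hSur hSinl y₀ hy₀ N hN e
    ⟨k₁, fun k hk j => ?_⟩
  intro inv hsum hperf ε hμ hadd₁ hadd₂ hgal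
  haveI := neZero_pow p j; haveI := neZero_pow p k
  haveI : Finite (geomTorsion W ((p ^ k : ℕ) : ℤ)) := finite_geomTorsion_pow W p k
  rw [kummer_inf_annLeft_image_eq_inf_ker W p k j ε hμ hadd₁ hadd₂ hgal inv _ y₀]
  exact hb k hk j inv hsum hperf ε hμ hadd₁ hadd₂ hgal

end Count

end Summit.BirchSwinnertonDyer.BirchSwinnertonDyer.Theorems.KatoFiniteLevelCount

end
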